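import Summits.Langlands.Langlands.Theorems.PhantomRMYoshidaResiduallyYoshidaLiftingGreenbergSelmerDefs
import HarnessLib

/-!
# Route `PhantomRMYoshida`, crux `ResiduallyYoshidaLifting` (stmt-Langlands-13639), line `sector-klingen-split`:
# stub RS `stub_selmerClassResiduallyOrdinary` — a strong Selmer class is residually Greenberg-ordinary of shape `(0,0,1,1)`

The registered sub-goal RS of the checked skeleton (rev 15, lead c5-0).  A cochain `B : Γ_ℚ → M₂(k)` satisfying the
decomposition-group Greenberg condition `IsGreenbergDecAt p k σ σ' v B` at `v` (Greenberg lines `k x₁ ⊆ σ̄`, `k y₁ ⊆ σ̄'`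
stable under `G_v` and fixed by `I_v`, and a correction `X₀` such that `B̃ := B - (σ̄ X₀ - X₀ σ̄')` maps `y₁` into `k x₁` on
`G_v`, kills `y₁` on `I_v` and maps all of `σ̄'` into `k x₁` on `I_v`) on a `DetC` fibre (`det σ̄' = det σ̄`) defines the
residual representation `τ ↦ (σ̄, B; 0, σ̄')(res τ)` of `G_v`, and this representation is block upper triangular in a
`GL₄(k)`-frame, with inertia acting trivially on the plane and through the scalar `det σ̄(res τ)` on the quotient.

**Proof (linear algebra, `exists_ordinaryFrame_of_greenbergDec`).**  Complete `x₁`, `y₁` to invertible `Px = [x₁ | x₂]`,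
`Py = [y₁ | y₂]`.  The frame `W = (Px, -X₀ Py; 0, Py)` has inverse `W⁻¹ = (Px⁻¹, Px⁻¹ X₀; 0, Py⁻¹)` and
`W⁻¹ (S, B; 0, S') W = (Px⁻¹ S Px, Px⁻¹ B̃ Py; 0, Py⁻¹ S' Py)` (`frame_conj_fromBlocks`).  In these coordinates the clauses
say: the first columns of `Px⁻¹ S Px`, `Py⁻¹ S' Py` are `(a, 0)`, `(b, 0)` (eigenlines) and `(1, 0)` on inertia; the first
column of `Px⁻¹ B̃ Py` is `(c, 0)`, and on inertia it vanishes and the whole second row of `Px⁻¹ B̃ Py` vanishes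
(`conj_apply_of_mulVec_col`); on inertia the `(1,1)` entries of `Px⁻¹ S Px`, `Py⁻¹ S' Py` are `det S = det S'`
(`conj_apply_one_one`).  Reordering the frame as `(x₁, 0), (-X₀ y₁, y₁), (x₂, 0), (-X₀ y₂, y₂)` — the shuffle
`(inl 0, inl 1, inr 0, inr 1) ↦ (inl 0, inr 0, inl 1, inr 1)` of `Fin 2 ⊕ Fin 2`, which regroups a block matrix into the
matrices of `(i, j)`-entries of its blocks (`fromBlocks_submatrix_blockSwap`) — the lower-left block collects the `(1,0)`
entries, all zero; the upper-left block collects the `(0,0)` entries, `= 1` on inertia; the lower-right block collects the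
`(1,1)` entries, `= det S • 1` on inertia.  Transport to `Fin 4` along `finSumFinEquiv`.

No new definitions; Mathlib only beyond the `Defs` currency; the core is stated over an
arbitrary index type `ι` with an inertia predicate `I` (reusable for the dual statement).
-/

noncomputable section

-- `Summit.Langlands.Langlands.…` (summit = sub-problem name, D-0017 layout) trips `dupNamespace` on every decl;
-- project-wide option (lakefile `weak.linter.dupNamespace = false`).
set_option linter.dupNamespace false
set_option autoImplicit false

open IsDedekindDomain Filter
open scoped Matrix
open Literature.NumberTheory.GaloisRepresentations Literature.NumberTheory.Automorphic
open Summit.Langlands.Langlands.Cruxes.ResiduallyYoshidaLifting.YoshidaDivisorSelmerCount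

namespace Summit.Langlands.Langlands.Cruxes.ResiduallyYoshidaLifting.SectorKlingenSplit.Fibre

section Core

variable {k : Type*} [Field k]

/-- A non-zero vector of `k²` is the first column of an invertible `2 × 2` matrix. [folklore] -/
theorem exists_det_ne_zero_col_zero_eq (x : Fin 2 → k) (hx : x ≠ 0) :
    ∃ P : Matrix (Fin 2) (Fin 2) k, P.det ≠ 0 ∧ P.col 0 = x := by
  by_cases h0 : x 0 = 0
  · have h1 : x 1 ≠ 0 := fun h1 => hx (by ext i; fin_cases i <;> simp [h0, h1])
    refine ⟨!![x 0, 1; x 1, 0], ?_, funext fun i => by fin_cases i <;> rfl⟩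
    rw [Matrix.det_fin_two_of, h0, zero_mul, one_mul, zero_sub, neg_ne_zero]
    exact h1
  · refine ⟨!![x 0, 0; x 1, 1], ?_, funext fun i => by fin_cases i <;> rfl⟩
    rw [Matrix.det_fin_two_of, mul_one, zero_mul, sub_zero]
    exact h0

/-- Columns through a conjugation: if `N` maps the `j`-th column of `P₂` to `a` times the first column of `P` and
`R P = 1`, then the `j`-th column of `R N P₂` is `(a, 0)`. [folklore] -/
theorem conj_apply_of_mulVec_col {R N P P₂ : Matrix (Fin 2) (Fin 2) k} {a : k} {j : Fin 2} (hRP : R * P = 1)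
    (hN : N *ᵥ P₂.col j = a • P.col 0) : (R * N * P₂) 0 j = a ∧ (R * N * P₂) 1 j = 0 := by
  have h : (R * N * P₂).col j = Pi.single 0 a := by
    rw [← Matrix.mulVec_single_one, ← Matrix.mulVec_mulVec, ← Matrix.mulVec_mulVec, Matrix.mulVec_single_one, hN,
      Matrix.mulVec_smul, ← Matrix.mulVec_single_one, Matrix.mulVec_mulVec, hRP, Matrix.one_mulVec,
      ← Pi.single_smul', smul_eq_mul, mul_one]
  exact ⟨by simpa using congrFun h 0, by simpa using congrFun h 1⟩

/-- The `(1,1)` entry of a conjugate `P⁻¹ N P` whose first column is `(1, 0)` is `det N`. [folklore] -/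
theorem conj_apply_one_one {P N : Matrix (Fin 2) (Fin 2) k} (hP : IsUnit P) (h00 : (P⁻¹ * N * P) 0 0 = 1)
    (h10 : (P⁻¹ * N * P) 1 0 = 0) : (P⁻¹ * N * P) 1 1 = N.det := by
  rw [← Matrix.det_conj' hP N, Matrix.det_fin_two, h00, h10, one_mul, mul_zero, sub_zero]

/-- Conjugating `(S, B; 0, S')` into the frame `W = (Px, -X₀ Py; 0, Py)` by `W⁻¹ = (Px⁻¹, Px⁻¹ X₀; 0, Py⁻¹)`: the blocks
become `Px⁻¹ S Px`, `Px⁻¹ (B - (S X₀ - X₀ S')) Py`, `0`, `Py⁻¹ S' Py` — the correction `X₀` is conjugated away. [folklore] -/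
theorem frame_conj_fromBlocks {n : Type*} [Fintype n] [DecidableEq n] {R : Type*} [CommRing R]
    (S S' B X₀ Px Py Pxi Pyi : Matrix n n R) :
    Matrix.fromBlocks Pxi (Pxi * X₀) 0 Pyi * Matrix.fromBlocks S B 0 S' * Matrix.fromBlocks Px (-(X₀ * Py)) 0 Py =
      Matrix.fromBlocks (Pxi * S * Px) (Pxi * (B - (S * X₀ - X₀ * S')) * Py) 0 (Pyi * S' * Py) := by
  simp only [Matrix.fromBlocks_multiply, Matrix.mul_zero, Matrix.zero_mul, add_zero, zero_add]
  rw [Matrix.fromBlocks_inj]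
  refine ⟨rfl, ?_, rfl, rfl⟩
  noncomm_ring

/-- `W⁻¹ W = 1` for the frame `W = (Px, -X₀ Py; 0, Py)`, `W⁻¹ = (Pxi, Pxi X₀; 0, Pyi)` (`Pxi Px = 1`, `Pyi Py = 1`).
[folklore] -/
theorem frame_inv_mul {n : Type*} [Fintype n] [DecidableEq n] {R : Type*} [CommRing R]
    {X₀ Px Py Pxi Pyi : Matrix n n R} (hx : Pxi * Px = 1) (hy : Pyi * Py = 1) :
    Matrix.fromBlocks Pxi (Pxi * X₀) 0 Pyi * Matrix.fromBlocks Px (-(X₀ * Py)) 0 Py = 1 := by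
  rw [Matrix.fromBlocks_multiply, ← Matrix.fromBlocks_one, Matrix.fromBlocks_inj]
  exact ⟨by rw [Matrix.mul_zero, add_zero, hx], by rw [Matrix.mul_neg, Matrix.mul_assoc, neg_add_cancel],
    by rw [Matrix.zero_mul, Matrix.mul_zero, add_zero], by rw [Matrix.zero_mul, zero_add, hy]⟩

/-- `W W⁻¹ = 1` for the frame `W = (Px, -X₀ Py; 0, Py)`, `W⁻¹ = (Pxi, Pxi X₀; 0, Pyi)` (`Px Pxi = 1`, `Py Pyi = 1`).
[folklore] -/
theorem frame_mul_inv {n : Type*} [Fintype n] [DecidableEq n] {R : Type*} [CommRing R]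
    {X₀ Px Py Pxi Pyi : Matrix n n R} (hx : Px * Pxi = 1) (hy : Py * Pyi = 1) :
    Matrix.fromBlocks Px (-(X₀ * Py)) 0 Py * Matrix.fromBlocks Pxi (Pxi * X₀) 0 Pyi = 1 := by
  rw [Matrix.fromBlocks_multiply, ← Matrix.fromBlocks_one, Matrix.fromBlocks_inj]
  refine ⟨by rw [Matrix.mul_zero, add_zero, hx], ?_, by rw [Matrix.zero_mul, Matrix.mul_zero, add_zero],
    by rw [Matrix.zero_mul, zero_add, hy]⟩
  rw [← Matrix.mul_assoc, hx, Matrix.one_mul, Matrix.neg_mul, Matrix.mul_assoc, hy, Matrix.mul_one, add_neg_cancel]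

/-- Row and column selections pass through a triple product: `M[r, ·] N P[·, c] = (M N P)[r, c]`. [folklore] -/
theorem submatrix_mul_mul_submatrix {l m : Type*} [Fintype m] {R : Type*} [CommRing R] (M N P : Matrix m m R)
    (r c : l → m) : M.submatrix r id * N * P.submatrix id c = (M * N * P).submatrix r c := by
  rw [Matrix.submatrix_mul _ _ r id c Function.bijective_id, Matrix.submatrix_mul _ _ r id id Function.bijective_id,
    Matrix.submatrix_id_id]

/-- `Matrix.reindex` along one equivalence is multiplicative. [folklore] -/
-- adapted from Theorems/PhantomRMYoshidaResiduallyYoshidaLiftingResidualConstancyOfRankOne.lean (private there)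
theorem reindex_mul_reindex' {R : Type*} [CommRing R] {m o : Type*} [Fintype m] [Fintype o]
    (e : m ≃ o) (M N : Matrix m m R) :
    Matrix.reindex e e M * Matrix.reindex e e N = Matrix.reindex e e (M * N) := by
  simp only [Matrix.reindex_apply, Matrix.submatrix_mul_equiv]

/-- The frame shuffle `(inl 0, inl 1, inr 0, inr 1) ↦ (inl 0, inr 0, inl 1, inr 1)` of `Fin 2 ⊕ Fin 2` (block `b`,
index `i` `↦` block `i`, index `b`) is an involution. [folklore] -/
theorem blockSwap_involutive :
    Function.Involutive (Sum.elim ![Sum.inl 0, Sum.inr 0] ![Sum.inl 1, Sum.inr 1] : Fin 2 ⊕ Fin 2 → Fin 2 ⊕ Fin 2) :=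
  fun x => by rcases x with x | x <;> fin_cases x <;> rfl

/-- The frame shuffle `(inl 0, inl 1, inr 0, inr 1) ↦ (inl 0, inr 0, inl 1, inr 1)` regroups a `2 × 2`-block matrix:
block `(i, j)` of the shuffled matrix is the matrix of `(i, j)`-entries of the four blocks. [folklore] -/
theorem fromBlocks_submatrix_blockSwap {α : Type*} (T₁₁ T₁₂ T₂₁ T₂₂ : Matrix (Fin 2) (Fin 2) α) :
    (Matrix.fromBlocks T₁₁ T₁₂ T₂₁ T₂₂).submatrix
        (Sum.elim ![Sum.inl 0, Sum.inr 0] ![Sum.inl 1, Sum.inr 1] : Fin 2 ⊕ Fin 2 → Fin 2 ⊕ Fin 2)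
        (Sum.elim ![Sum.inl 0, Sum.inr 0] ![Sum.inl 1, Sum.inr 1] : Fin 2 ⊕ Fin 2 → Fin 2 ⊕ Fin 2) =
      Matrix.fromBlocks !![T₁₁ 0 0, T₁₂ 0 0; T₂₁ 0 0, T₂₂ 0 0] !![T₁₁ 0 1, T₁₂ 0 1; T₂₁ 0 1, T₂₂ 0 1]
        !![T₁₁ 1 0, T₁₂ 1 0; T₂₁ 1 0, T₂₂ 1 0] !![T₁₁ 1 1, T₁₂ 1 1; T₂₁ 1 1, T₂₂ 1 1] := by
  ext (i | i) (j | j) <;> fin_cases i <;> fin_cases j <;> rfl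

/-- The zero `2 × 2` matrix in bracket notation. [folklore] -/
theorem etaFinTwo_zero : !![(0 : k), 0; 0, 0] = 0 := by
  ext i j; fin_cases i <;> fin_cases j <;> rfl

/-- **The linear algebra of the residual ordinary frame** (core of `stub_selmerClassResiduallyOrdinary`, over an arbitrary
index type `ι` with an inertia predicate `I`).  Let `S, S', B : ι → M₂(k)`, a correction `X₀`, and non-zero `x₁, y₁` with:
`S i x₁ ∈ k x₁`, `S' i y₁ ∈ k y₁`, `B̃ i y₁ ∈ k x₁` for all `i` (`B̃ i := B i - (S i X₀ - X₀ S' i)`), and for `I i`: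
`S i x₁ = x₁`, `S' i y₁ = y₁`, `B̃ i y₁ = 0`, `B̃ i (k²) ⊆ k x₁`, `det S' i = det S i`.  Then there are `Q ∈ GL₄(k)` and
`A, C, D : ι → M₂(k)` with `Q (S i, B i; 0, S' i) Q⁻¹ = (A i, C i; 0, D i)` (transported along `finSumFinEquiv`),
`A i = 1` and `D i = det S i • 1` for `I i`: the frame `(x₁, 0), (-X₀ y₁, y₁), (x₂, 0), (-X₀ y₂, y₂)`. [folklore] -/
theorem exists_ordinaryFrame_of_greenbergDec {ι : Type*} (I : ι → Prop) (S S' B : ι → Matrix (Fin 2) (Fin 2) k)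
    (X₀ : Matrix (Fin 2) (Fin 2) k) (x₁ y₁ : Fin 2 → k) (hx : x₁ ≠ 0) (hy : y₁ ≠ 0)
    (ha : ∀ i, ∃ a : k, S i *ᵥ x₁ = a • x₁) (hb : ∀ i, ∃ b : k, S' i *ᵥ y₁ = b • y₁)
    (hc : ∀ i, ∃ c : k, (B i - (S i * X₀ - X₀ * S' i)) *ᵥ y₁ = c • x₁)
    (hIa : ∀ i, I i → S i *ᵥ x₁ = x₁) (hIb : ∀ i, I i → S' i *ᵥ y₁ = y₁)
    (hIc : ∀ i, I i → (B i - (S i * X₀ - X₀ * S' i)) *ᵥ y₁ = 0)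
    (hId : ∀ i, I i → ∀ y : Fin 2 → k, ∃ c : k, (B i - (S i * X₀ - X₀ * S' i)) *ᵥ y = c • x₁)
    (hdet : ∀ i, I i → (S' i).det = (S i).det) :
    ∃ (Q : GL (Fin 4) k) (A C D : ι → Matrix (Fin 2) (Fin 2) k),
      (∀ i, Q.val * Matrix.reindex finSumFinEquiv finSumFinEquiv (Matrix.fromBlocks (S i) (B i) 0 (S' i)) *
          (Q⁻¹).val = Matrix.reindex finSumFinEquiv finSumFinEquiv (Matrix.fromBlocks (A i) (C i) 0 (D i))) ∧
      (∀ i, I i → A i = 1) ∧ (∀ i, I i → D i = (S i).det • (1 : Matrix (Fin 2) (Fin 2) k)) := by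
  classical
  obtain ⟨Px, hPx, rfl⟩ := exists_det_ne_zero_col_zero_eq x₁ hx
  obtain ⟨Py, hPy, rfl⟩ := exists_det_ne_zero_col_zero_eq y₁ hy
  have hUx : IsUnit Px := (Matrix.isUnit_iff_isUnit_det Px).2 (isUnit_iff_ne_zero.2 hPx)
  have hUy : IsUnit Py := (Matrix.isUnit_iff_isUnit_det Py).2 (isUnit_iff_ne_zero.2 hPy)
  have hix : Px⁻¹ * Px = 1 := Matrix.nonsing_inv_mul Px (isUnit_iff_ne_zero.2 hPx)
  have hix' : Px * Px⁻¹ = 1 := Matrix.mul_nonsing_inv Px (isUnit_iff_ne_zero.2 hPx)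
  have hiy : Py⁻¹ * Py = 1 := Matrix.nonsing_inv_mul Py (isUnit_iff_ne_zero.2 hPy)
  have hiy' : Py * Py⁻¹ = 1 := Matrix.mul_nonsing_inv Py (isUnit_iff_ne_zero.2 hPy)
  -- the entries of the conjugated blocks read off the clauses
  have e1 : ∀ i, (Px⁻¹ * S i * Px) 1 0 = 0 := fun i => by
    obtain ⟨a, h⟩ := ha i
    exact (conj_apply_of_mulVec_col hix h).2
  have e2 : ∀ i, (Py⁻¹ * S' i * Py) 1 0 = 0 := fun i => by
    obtain ⟨b, h⟩ := hb i
    exact (conj_apply_of_mulVec_col hiy h).2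
  have e3 : ∀ i, (Px⁻¹ * (B i - (S i * X₀ - X₀ * S' i)) * Py) 1 0 = 0 := fun i => by
    obtain ⟨c, h⟩ := hc i
    exact (conj_apply_of_mulVec_col hix h).2
  have f1 : ∀ i, I i → (Px⁻¹ * S i * Px) 0 0 = 1 ∧ (Px⁻¹ * S i * Px) 1 0 = 0 := fun i hi => by
    have h : S i *ᵥ Px.col 0 = (1 : k) • Px.col 0 := by rw [one_smul]; exact hIa i hi
    exact conj_apply_of_mulVec_col hix h
  have f2 : ∀ i, I i → (Py⁻¹ * S' i * Py) 0 0 = 1 ∧ (Py⁻¹ * S' i * Py) 1 0 = 0 := fun i hi => by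
    have h : S' i *ᵥ Py.col 0 = (1 : k) • Py.col 0 := by rw [one_smul]; exact hIb i hi
    exact conj_apply_of_mulVec_col hiy h
  have f3 : ∀ i, I i → (Px⁻¹ * (B i - (S i * X₀ - X₀ * S' i)) * Py) 0 0 = 0 := fun i hi => by
    have h : (B i - (S i * X₀ - X₀ * S' i)) *ᵥ Py.col 0 = (0 : k) • Px.col 0 := by
      rw [zero_smul]; exact hIc i hi
    exact (conj_apply_of_mulVec_col hix h).1
  have f4 : ∀ i, I i → (Px⁻¹ * (B i - (S i * X₀ - X₀ * S' i)) * Py) 1 1 = 0 := fun i hi => by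
    obtain ⟨c, h⟩ := hId i hi (Py.col 1)
    exact (conj_apply_of_mulVec_col hix h).2
  have f5 : ∀ i, I i → (Px⁻¹ * S i * Px) 1 1 = (S i).det := fun i hi =>
    conj_apply_one_one hUx (f1 i hi).1 (f1 i hi).2
  have f6 : ∀ i, I i → (Py⁻¹ * S' i * Py) 1 1 = (S i).det := fun i hi =>
    (conj_apply_one_one hUy (f2 i hi).1 (f2 i hi).2).trans (hdet i hi)
  -- the frame `W = (Px, -X₀ Py; 0, Py)`, its inverse, and the shuffled transport to `Fin 4`
  have hW'W : Matrix.fromBlocks Px⁻¹ (Px⁻¹ * X₀) 0 Py⁻¹ * Matrix.fromBlocks Px (-(X₀ * Py)) 0 Py = 1 :=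
    frame_inv_mul hix hiy
  have hWW' : Matrix.fromBlocks Px (-(X₀ * Py)) 0 Py * Matrix.fromBlocks Px⁻¹ (Px⁻¹ * X₀) 0 Py⁻¹ = 1 :=
    frame_mul_inv hix' hiy'
  set Qv : Matrix (Fin 4) (Fin 4) k := Matrix.reindex finSumFinEquiv finSumFinEquiv
    ((Matrix.fromBlocks Px⁻¹ (Px⁻¹ * X₀) 0 Py⁻¹).submatrix
      (Sum.elim ![Sum.inl 0, Sum.inr 0] ![Sum.inl 1, Sum.inr 1] : Fin 2 ⊕ Fin 2 → Fin 2 ⊕ Fin 2) id) with hQv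
  set Qi : Matrix (Fin 4) (Fin 4) k := Matrix.reindex finSumFinEquiv finSumFinEquiv
    ((Matrix.fromBlocks Px (-(X₀ * Py)) 0 Py).submatrix id
      (Sum.elim ![Sum.inl 0, Sum.inr 0] ![Sum.inl 1, Sum.inr 1] : Fin 2 ⊕ Fin 2 → Fin 2 ⊕ Fin 2)) with hQi
  have hvi : Qv * Qi = 1 := by
    rw [hQv, hQi, reindex_mul_reindex', ← Matrix.submatrix_mul _ _ _ id _ Function.bijective_id, hW'W,
      Matrix.submatrix_one _ blockSwap_involutive.injective, Matrix.reindex_apply, Matrix.submatrix_one_equiv]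
  have hiv : Qi * Qv = 1 := by
    rw [hQv, hQi, reindex_mul_reindex', ← Matrix.submatrix_mul _ _ id _ id blockSwap_involutive.bijective, hWW',
      Matrix.submatrix_id_id, Matrix.reindex_apply, Matrix.submatrix_one_equiv]
  refine ⟨⟨Qv, Qi, hvi, hiv⟩,
    fun i => !![(Px⁻¹ * S i * Px) 0 0, (Px⁻¹ * (B i - (S i * X₀ - X₀ * S' i)) * Py) 0 0;
      0, (Py⁻¹ * S' i * Py) 0 0],
    fun i => !![(Px⁻¹ * S i * Px) 0 1, (Px⁻¹ * (B i - (S i * X₀ - X₀ * S' i)) * Py) 0 1;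
      0, (Py⁻¹ * S' i * Py) 0 1],
    fun i => !![(Px⁻¹ * S i * Px) 1 1, (Px⁻¹ * (B i - (S i * X₀ - X₀ * S' i)) * Py) 1 1;
      0, (Py⁻¹ * S' i * Py) 1 1],
    fun i => ?_, fun i hi => ?_, fun i hi => ?_⟩
  · -- block upper triangular in the shuffled frame
    show Qv * _ * Qi = _
    rw [hQv, hQi, reindex_mul_reindex', reindex_mul_reindex', submatrix_mul_mul_submatrix, frame_conj_fromBlocks,
      fromBlocks_submatrix_blockSwap]
    simp only [Matrix.zero_apply, e1 i, e2 i, e3 i, etaFinTwo_zero]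
  · -- inertia acts trivially on the plane
    simp only [(f1 i hi).1, (f2 i hi).1, f3 i hi]
    exact Matrix.one_fin_two.symm
  · -- inertia acts through `det S i` on the quotient
    simp only [f4 i hi, f5 i hi, f6 i hi]
    ext a b
    fin_cases a <;> fin_cases b <;> simp

end Core

/-- **Registered sub-goal RS `stub_selmerClassResiduallyOrdinary`** (crux stmt-Langlands-13639, line `sector-klingen-split`,
skeleton rev 15; the converse of N1⁺ at the residual level): a cochain `B` satisfying the decomposition-group Greenberg
condition `IsGreenbergDecAt` at `v ∣ p` on a `DetC` fibre defines a residual representation `τ ↦ (σ̄, B; 0, σ̄')(res τ)` of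
`G_v` which is RESIDUALLY GREENBERG-ORDINARY OF SHAPE `(0,0,1,1)`: in the `GL₄(k)`-frame
`(x₁,0), (-X₀ y₁, y₁), (x₂,0), (-X₀ y₂, y₂)` it is block upper triangular, inertia acts TRIVIALLY on the plane and through
the SCALAR `det σ̄ = ε̄⁻¹` on the quotient.  Every strong Selmer class — realised or not — is a point of the residual local
condition of `R^{Sh}(ρ̄_B)`. [cite: Greenberg1991, §2 (the ordinary local condition)] -/
theorem stub_selmerClassResiduallyOrdinary :
    ∀ (p : ℕ) [Fact p.Prime] (k : Type) [Field k] [CharP k p] [TopologicalSpace k] [DiscreteTopology k]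
      (σ σ' : FramedGaloisRep ℚ k 2) (v : HeightOneSpectrum (NumberField.RingOfIntegers ℚ))
      (B : Field.absoluteGaloisGroup ℚ → Matrix (Fin 2) (Fin 2) k),
      DetC p k σ σ' → IsGreenbergDecAt p k σ σ' v B →
      ∃ (Q : GL (Fin 4) k) (A C D : Field.absoluteGaloisGroup (v.adicCompletion ℚ) → Matrix (Fin 2) (Fin 2) k),
        (∀ τ, Q.val * Matrix.reindex finSumFinEquiv finSumFinEquiv
              (Matrix.fromBlocks (σ (absGaloisRestrict ℚ (v.adicCompletion ℚ) τ)).val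
                (B (absGaloisRestrict ℚ (v.adicCompletion ℚ) τ)) 0
                (σ' (absGaloisRestrict ℚ (v.adicCompletion ℚ) τ)).val) * (Q⁻¹).val =
            Matrix.reindex finSumFinEquiv finSumFinEquiv (Matrix.fromBlocks (A τ) (C τ) 0 (D τ))) ∧
        (∀ τ ∈ absInertia (v.adicCompletion ℚ), A τ = 1) ∧
        (∀ τ ∈ absInertia (v.adicCompletion ℚ),
          D τ = (σ (absGaloisRestrict ℚ (v.adicCompletion ℚ) τ)).val.det • (1 : Matrix (Fin 2) (Fin 2) k)) := by
  intro p _ k _ _ _ _ σ σ' v B hDet hGr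
  obtain ⟨X₀, x₁, y₁, hx, hy, ha, hb, hc, hIa, hIb, hIc, hId⟩ := hGr
  have hdet : ∀ τ : Field.absoluteGaloisGroup (v.adicCompletion ℚ),
      (σ' (absGaloisRestrict ℚ (v.adicCompletion ℚ) τ)).val.det =
        (σ (absGaloisRestrict ℚ (v.adicCompletion ℚ) τ)).val.det := fun τ => by
    have h := congrArg Units.val (hDet (absGaloisRestrict ℚ (v.adicCompletion ℚ) τ)).2
    simpa only [FramedRep.det_apply, Matrix.GeneralLinearGroup.val_det_apply] using h
  exact exists_ordinaryFrame_of_greenbergDec (fun τ => τ ∈ absInertia (v.adicCompletion ℚ))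
    (fun τ => (σ (absGaloisRestrict ℚ (v.adicCompletion ℚ) τ)).val)
    (fun τ => (σ' (absGaloisRestrict ℚ (v.adicCompletion ℚ) τ)).val)
    (fun τ => B (absGaloisRestrict ℚ (v.adicCompletion ℚ) τ)) X₀ x₁ y₁ hx hy ha hb hc hIa hIb hIc hId
    (fun τ _ => hdet τ)

end Summit.Langlands.Langlands.Cruxes.ResiduallyYoshidaLifting.SectorKlingenSplit.Fibre

end
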